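import Summits.BirchSwinnertonDyer.Rank1Residual.Additive.DisegniLineLeadingCoeff
import Summits.BirchSwinnertonDyer.Rank1Residual.Additive.DisegniLineDescent
import Summits.BirchSwinnertonDyer.Rank1Residual.Additive.GordBranchPAdicGrossZagier
import Literature.NumberTheory.EllipticCurves.GrossZagierRationalPoint
import Literature.NumberTheory.EllipticCurves.RegulatorProofs
import HarnessLib

/-!
# STEP C(2) of the kernel derivation of `hFact`: the twisted-branch `p`-adic Gross–Zagier identity at
# one admissible `(V, f, ϖ)` from Disegni's clauses (cell `bsd-addord`, seat `bsd-addord-gz` gen 4)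

HONEST FRAMING (cell `bsd-addord`; PARTITION (D-0054): EXCLUDED-DOMAIN additive rows §E, B6 = O7-ord r1 ×
every consumer of hFact — types-the-object-of; booked 0). THEOREMS ONLY. For `E = W` additive at
`p ≡ 1 (mod 4)` of analytic rank one, `W ≅ V ⊗ χ_p` with `V` good ordinary (newform `f`, `ϖ·Ω_V = Ω⁺_f`),
a quadratic field `K` (Kronecker character `κ`, `p ∤ d_K`, `rank E^{(d_K)}(ℚ) = 0`), the newform `f′` of
the good ordinary twist `V′ ≅ V ⊗ κ` (`a_p(V′) = a_p(V)`, `∑(a/p)[a/p]⁺_{f′} ≠ 0`), the newform `f_E` of `E`,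
and a pair of height data `Dh`, `DhK` (restriction factor `1`) carrying Disegni's clauses
`CycLineGrossZagierClauses W K ι f_E α DhK` (lit p408713; the conjoined fact (B) = p409418 supplies them):

  `∃ u ∈ ℤ_p^×, q ∈ ℚ:  L′(E,1) = q·Ω_E·Reg_∞(E)  ∧  ϖ·[T¹]L_p(f,α,ω^{(p−1)/2},T)·log_p γ = u·q·Reg_p(E,Dh)`

(`branchPAdicGrossZagier_identity_of_cycLine`) — the EVEN GOOD-ORDINARY clause of the seat's reading
`TwistedBranchGrossZagierAt` / the typed input `BranchPAdicGrossZagierAt`, now DERIVED. Inputs displayed as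
hypotheses (all PUBLISHED, most of them tree theorems): STEP B(2) (`coeff_one_cycLine_eq`), STEP C(1)
(`exists_rat_heightPairing_eq_and_pairing_eq`), the Artin formalism `hArt` (lit p408789), Gross–Zagier
I.(7.3) `h73` (rationality of `L′(E,1)/(Ω R)`), Pal's period relation `hPal`, modularity `hmod`,
Gross–Zagier–Kolyvagin `hGZK`, Birch's formula and `τ(χ_p)² = p` (tree theorems). The computation:
Thm. B gives `ρ·Reg_p = σ₀ q Z°⁻¹ ½ log_p γ · ι⁻¹(X) · [T¹]B_f · α⁻¹S′` and (1.1.3) gives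
`ρ·Reg_∞ = (q/2)·Car·L′(E,1)·L(f′,χ_p,1)`; with `L′(E,1) = c·Ω_E·Reg_∞`, `S′Ω⁺_{f′} = τ(χ_p)L(f′,χ_p,1)`,
`Ω⁺_f = ϖ√pΩ_E`: `X := u·Car·Ω⁺_f·Ω⁺_{f′} = ±2uϖρp/(qcS′) ∈ ℚ`, and `Z° = u·p·α⁻²` makes every `p`-power and
`u` cancel: `ϖ·[T¹]B_f·log_p γ = (±α⁻¹)·c·Reg_p`.

References: [Disegni2017] Thm. A/B, (1.1.3); [GrossZagier1986] Thm. I.(7.3); [Pal2012] Thm. 3.2; [MazurTateTeitelbaum1986Invent] §I.8, §I.14.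
-/

set_option autoImplicit false

noncomputable section

open scoped Classical MatrixGroups ModularForm NumberField

open CongruenceSubgroup WeierstrassCurve NumberField Literature.NumberTheory.EllipticCurves
  Literature.NumberTheory.EllipticCurves.ModularForms Literature.NumberTheory.EllipticCurves.Rank1Residual
  Literature.NumberTheory.EllipticCurves.Disegni2017 Literature.NumberTheory.QuadraticFields
  Literature.NumberTheory.GaloisRepresentations

namespace Summit.BirchSwinnertonDyer.Rank1Residual.Additive

section Identity

variable {W : WeierstrassCurve ℚ} [W.IsElliptic] [W.IsGloballyMinimal] {p : ℕ} [hp : Fact p.Prime]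
  (ι : PadicAlgCl p ≃+* ℂ) (K : Type) [Field K] [NumberField K] [IsGalois ℚ K]

/-- `ι⁻¹` of a rational complex number, pushed into `ℂ_p`, is that rational. [folklore] -/
theorem coe_symm_ratCast (r : ℚ) : ((ι.symm (r : ℂ) : PadicAlgCl p) : ℂ_[p]) = (r : ℂ_[p]) := by
  have h : ι.symm (r : ℂ) = (r : PadicAlgCl p) := map_ratCast ι.symm r
  rw [h, PadicComplex.coe_eq, map_ratCast]

/-- **The archimedean bookkeeping** (pure field algebra in `ℂ`): from (1.1.3) in the form
`ρ·R = (q/2)·Car·(c·Ω·R)·L`, Birch `S·Ω⁺_{f′} = τ·L`, `τ·√p = ε·p` and Pal `Ω⁺_f = ϖ·√p·Ω`: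
`ρ ≠ 0` and `u·Car·Ω⁺_f·Ω⁺_{f′} = ε·2uϖρp/(qcS)`. [cite: Disegni2017, (1.1.3) (arXiv v3 PDF pp. 4–5)] -/
theorem arch_algebra {ρ q c S u ϖ ε : ℚ} {p' : ℕ} {Car Ω R Ωf Ωf' sq : ℝ} {τ L : ℂ}
    (hA : (ρ : ℂ) * R = (q : ℂ) / 2 * Car * ((c : ℂ) * Ω * R * L))
    (hB : ((S : ℚ) : ℂ) * Ωf' = τ * L) (hτ : τ * (sq : ℂ) = (ε : ℂ) * (p' : ℂ))
    (hΩf : (Ωf : ℂ) = (ϖ : ℂ) * sq * Ω)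
    (hR : (R : ℂ) ≠ 0) (hΩ : (Ω : ℂ) ≠ 0) (hq : (q : ℂ) ≠ 0) (hc : (c : ℂ) ≠ 0) (hS : (S : ℂ) ≠ 0)
    (hCar : (Car : ℂ) ≠ 0) (hΩf' : (Ωf' : ℂ) ≠ 0) :
    ρ ≠ 0 ∧ (u : ℂ) * Car * Ωf * Ωf' = ((ε * (2 * u * ϖ * ρ * p' / (q * c * S)) : ℚ) : ℂ) := by
  have h1 : (ρ : ℂ) = (q : ℂ) / 2 * Car * c * Ω * L := by
    apply mul_right_cancel₀ hR
    linear_combination hA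
  have hρ : ρ ≠ 0 := by
    intro hρ0
    rw [hρ0, Rat.cast_zero] at h1
    have hL : L = 0 := by
      have h0 : (q : ℂ) / 2 * Car * c * Ω * L = 0 := h1.symm
      have hA0 : (q : ℂ) / 2 * Car * c * Ω ≠ 0 :=
        mul_ne_zero (mul_ne_zero (mul_ne_zero (div_ne_zero hq two_ne_zero) hCar) hc) hΩ
      exact (mul_eq_zero.mp h0).resolve_left hA0
    rw [hL, mul_zero] at hB
    exact mul_ne_zero hS hΩf' hB
  refine ⟨hρ, ?_⟩
  have hΩf'eq : (Ωf' : ℂ) = τ * L / (S : ℂ) := by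
    field_simp
    linear_combination hB
  calc (u : ℂ) * Car * Ωf * Ωf'
      = (u : ℂ) * Car * ϖ * Ω * L / (S : ℂ) * (τ * (sq : ℂ)) := by
        rw [hΩf, hΩf'eq]; field_simp
    _ = (u : ℂ) * Car * ϖ * Ω * L / (S : ℂ) * ((ε : ℂ) * (p' : ℂ)) := by rw [hτ]
    _ = ((ε * (2 * u * ϖ * ρ * p' / (q * c * S)) : ℚ) : ℂ) := by
        push_cast
        rw [h1]
        field_simp

/-- **The `p`-adic bookkeeping** (pure field algebra in `ℚ_p`): Theorem B in the form
`ρ·Reg = σ q (u·p·α⁻²)⁻¹ ½ ℓ · (ε·2uϖρp/(qcS)) · B · α⁻¹S` gives `ϖ·B·ℓ = (σεα⁻¹)·c·Reg` — every power of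
`p` and the constant `u` cancel. [cite: Disegni2017, Theorem B (arXiv v3 PDF p. 9)] -/
theorem padic_algebra {ρ q c S u ϖ ε : ℚ} {σ : ℤ} {pp α ℓ B Reg : ℚ_[p]}
    (hPad : (ρ : ℚ_[p]) * Reg = (σ : ℚ_[p]) * (q : ℚ_[p]) *
        (((u : ℚ_[p]) * pp * (α ^ 2)⁻¹)⁻¹ * 2⁻¹ * ℓ) *
        (((ε * (2 * u * ϖ * ρ * p / (q * c * S)) : ℚ) : ℚ_[p]) * B * (α⁻¹ * (S : ℚ_[p]))))
    (hpp : pp = (p : ℚ_[p])) (hs2 : ((σ : ℚ_[p]) * (ε : ℚ_[p])) ^ 2 = 1)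
    (hρ : (ρ : ℚ_[p]) ≠ 0) (hq : (q : ℚ_[p]) ≠ 0) (hc : (c : ℚ_[p]) ≠ 0) (hS : (S : ℚ_[p]) ≠ 0)
    (hu : (u : ℚ_[p]) ≠ 0) (hα : α ≠ 0) (hp0 : (p : ℚ_[p]) ≠ 0) :
    (ϖ : ℚ_[p]) * B * ℓ = ((σ : ℚ_[p]) * (ε : ℚ_[p]) * α⁻¹) * (c : ℚ_[p]) * Reg := by
  subst hpp
  have h3 : (ρ : ℚ_[p]) * Reg =
      (σ : ℚ_[p]) * (ε : ℚ_[p]) * α * (ϖ : ℚ_[p]) * (ρ : ℚ_[p]) * ℓ * B / (c : ℚ_[p]) := by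
    rw [hPad]
    push_cast
    field_simp
  have h4 : (c : ℚ_[p]) * Reg = (σ : ℚ_[p]) * (ε : ℚ_[p]) * α * (ϖ : ℚ_[p]) * ℓ * B := by
    have h5 : (c : ℚ_[p]) * ((ρ : ℚ_[p]) * Reg) =
        (ρ : ℚ_[p]) * ((σ : ℚ_[p]) * (ε : ℚ_[p]) * α * (ϖ : ℚ_[p]) * ℓ * B) := by
      rw [h3]; field_simp
    apply mul_left_cancel₀ hρ
    linear_combination h5
  calc (ϖ : ℚ_[p]) * B * ℓ
      = ((σ : ℚ_[p]) * (ε : ℚ_[p])) ^ 2 * ((ϖ : ℚ_[p]) * B * ℓ) := by rw [hs2, one_mul]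
    _ = ((σ : ℚ_[p]) * (ε : ℚ_[p]) * α⁻¹) *
          ((σ : ℚ_[p]) * (ε : ℚ_[p]) * α * (ϖ : ℚ_[p]) * ℓ * B) := by
        field_simp
    _ = ((σ : ℚ_[p]) * (ε : ℚ_[p]) * α⁻¹) * ((c : ℚ_[p]) * Reg) := by rw [h4]
    _ = ((σ : ℚ_[p]) * (ε : ℚ_[p]) * α⁻¹) * (c : ℚ_[p]) * Reg := by ring


/-- **STEP C(2a) — the archimedean side: Disegni's (1.1.3)-clause makes `u·Car·Ω⁺_f·Ω⁺_{f′}`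
rational.** With the Artin formalism (`hArt`), the continuation of `L(f_E × 𝟙_K, s)` is
`L(E,s)·L₂(s)`, `L₂` continuing `L(f′, χ_p, s)`; `L(E,1) = 0`, `L′(E,1) = c·Ω_E·R` (input `hcL`),
Birch `S′Ω⁺_{f′} = τ(χ_p)L₂(1)`, `τ(χ_p)² = p` and Pal give `ρ ≠ 0` and
`u·Car·Ω⁺_f·Ω⁺_{f′} = ε·2uϖρp/(qcS′)` for a sign `ε`.
[cite: Disegni2017, (1.1.3)–(1.1.4) (arXiv v3 PDF pp. 4–5)] [cite: Pal2012, Thm. 3.2]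
[cite: MazurTateTeitelbaum1986Invent, §I.8 (8.6)] -/
theorem archRatioClause_rational (hp4 : p % 4 = 1)
    (hArt : rankinSelbergEulerProductHecke_baseChangeDirichlet_eq)
    (hPal : Pal2012.thm32_sqrt_mul_realPeriodRat_twist_eq_of_prime_one_mod_four)
    (hmod : hasEntireLFunction_rat)
    (h2 : Module.finrank ℚ K = 2) (κ : DirichletCharacter ℂ (NumberField.discr K).natAbs)
    (hκ : ∀ ℓ : ℕ, ℓ.Prime → ℓ ≠ 2 → κ ℓ = (jacobiSym (NumberField.discr K) ℓ : ℂ))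
    (hκ2 : κ 2 = if NumberField.discr K % 8 = 1 then 1
        else if NumberField.discr K % 8 = 5 then -1 else 0)
    (hadd : Addv W p) (hr : W.analyticRank = 1)
    (V V' : WeierstrassCurve ℚ) [V.IsElliptic] [V.IsGloballyMinimal] [V'.IsElliptic] [V'.IsGloballyMinimal]
    (hVW : ∃ C : VariableChange ℚ, C • V.quadraticTwist (p : ℚ) = W) (hord : GoodOrd V p)
    {N NE N' : ℕ} [NeZero N] [NeZero NE] [NeZero N'] {f : CuspForm (Gamma0 N) 2}
    {fE : CuspForm (Gamma0 NE) 2} {f' : CuspForm (Gamma0 N') 2}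
    (hfV : IsNewformOf V f) (hfE : IsNewformOf W fE) (hfV' : IsNewformOf V' f')
    (hV' : ∀ n : ℕ, cuspCoeff f' n = κ (n : ZMod (NumberField.discr K).natAbs) * cuspCoeff f n)
    (hS' : legendrePlusSymbolSum f' p ≠ 0)
    (ϖ : ℚ) (hϖ : (ϖ : ℝ) * V.realPeriodRat = plusPeriod f)
    {c : ℚ} (hc : c ≠ 0)
    (hcL : deriv W.entireLFunction 1 = (((c : ℝ) * W.realPeriodRat * W.regulator : ℝ) : ℂ))
    {Car : ℝ} (hCar : 0 < Car) {P₁ P₂ : (W.baseChange K).toAffine.Point} {q ρ : ℚ} (hq : q ≠ 0)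
    (hArch : ArchRatioClause W K fE Car P₁ P₂ q)
    (hρR : (P₁.heightPairing P₂ : ℝ) = (ρ : ℝ) * (2 : ℕ) * W.regulator) :
    ρ ≠ 0 ∧ ∃ ε : ℚ, (ε = 1 ∨ ε = -1) ∧
      (splitLocalConstant p : ℂ) * (Car : ℂ) * (plusPeriod f : ℂ) * (plusPeriod f' : ℂ) =
        ((ε * (2 * splitLocalConstant p * ϖ * ρ * p / (q * c * legendrePlusSymbolSum f' p)) : ℚ) : ℂ) := by
  haveI : NeZero p := ⟨hp.out.ne_zero⟩
  haveI : NeZero (NumberField.discr K).natAbs :=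
    ⟨Int.natAbs_ne_zero.mpr (NumberField.discr_ne_zero K)⟩
  have hpP : p.Prime := hp.out
  have hp2 : p ≠ 2 := by omega
  have hEnt : W.HasEntireLFunction := hmod W
  -- the coefficient relation `a_n(f_E) = (n/p)·a_n(f)`
  have hE : ∀ n : ℕ, cuspCoeff fE n = (legendreSym p (n : ℤ) : ℂ) * cuspCoeff f n := by
    intro n
    rw [hfE.2 n, intCast_LFunction_eq_jacobiChar_mul_cuspCoeff p hp4 V W hVW hadd hfV n,
      jacobiChar_natCast, ← jacobiSym.legendreSym.to_jacobiSym]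
  -- the Legendre character and the continuation of `L(f', χ_p, s)`
  obtain ⟨hχ1, hχq, hχprim⟩ := jacobiChar_prime_ne_one_isQuadratic_isPrimitive p hp2
  have hχe := jacobiChar_even_of_mod_four_eq_one p hp4
  set χ := jacobiChar p with hχdef
  obtain ⟨L₂, hL₂d, hL₂⟩ := exists_differentiable_eq_twistedLSeries_holds f' χ
  -- the product `L(E,s)·L₂(s)` continues `L(f_E × 𝟙_K, s)` (Artin + coefficient relations)
  have hΛeq : ∀ s : ℂ, 2 < s.re →
      W.entireLFunction s * L₂ s = rankinSelbergEulerProductHecke fE (1 : HeckeCharacter K) s := by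
    intro s hs
    rw [hArt.trivial K h2 κ hκ hκ2 fE hfE.1 hs, W.entireLFunction_eq_LSeries hEnt (by linarith),
      hL₂ s hs]
    congr 1
    · rw [LSeries_eq_twistedLSeries_of_coeff W fE (1 : DirichletCharacter ℂ 1) (fun n ↦ by
        rw [MulChar.one_apply (isUnit_of_subsingleton _), one_mul, hfE.2 n])]
    · unfold twistedLSeries
      refine LSeries_congr (fun {n} _ ↦ ?_) s
      rw [dirichletCharacter_mul_natCast, MulChar.one_apply (isUnit_of_subsingleton _), one_mul,
        hV' n, hE n, hχdef, jacobiChar_natCast, ← jacobiSym.legendreSym.to_jacobiSym]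
      ring
  have hΛd : Differentiable ℂ (fun s ↦ W.entireLFunction s * L₂ s) :=
    (W.differentiable_entireLFunction hEnt).mul hL₂d
  have hA := hArch (fun s ↦ W.entireLFunction s * L₂ s) hΛd hΛeq
  have hL0 : W.entireLFunction 1 = 0 := entireLFunction_one_eq_zero_of_analyticRank_eq_one hr
  have hderiv : deriv (fun s ↦ W.entireLFunction s * L₂ s) 1 = deriv W.entireLFunction 1 * L₂ 1 := by
    rw [deriv_fun_mul (W.differentiable_entireLFunction hEnt 1) (hL₂d 1), hL0, zero_mul, add_zero]
  rw [hderiv, hcL] at hA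
  -- Birch for `f'` at `χ_p`: `S'·Ω⁺_{f'} = τ·L₂(1)`, `τ² = p`
  have hBirch := ratTwistedSymbolSum_mul_plusPeriod_holds hfV'.1 hfV'.coeffField_eq_bot hχprim hχe hL₂d
    (fun s hs ↦ by rw [hχq.inv]; exact hL₂ s hs)
  rw [← cast_legendrePlusSymbolSum_eq_ratTwistedSymbolSum p f'] at hBirch
  set τ : ℂ := gaussSum χ (ZMod.stdAddChar (N := p)) with hτdef
  have hτsq : τ ^ 2 = (p : ℂ) := by
    rw [hτdef, gaussSum_sq hχ1 hχq (ZMod.isPrimitive_stdAddChar p), hχe, one_mul, ZMod.card]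
  have hsqrt : ((Real.sqrt p : ℝ) : ℂ) ^ 2 = (p : ℂ) := by
    rw [← Complex.ofReal_pow, Real.sq_sqrt (Nat.cast_nonneg p)]
    push_cast
    rfl
  -- `τ·√p = ε·p`, `ε = ±1`
  obtain ⟨ε, hε, hτp⟩ : ∃ ε : ℚ, (ε = 1 ∨ ε = -1) ∧ τ * (Real.sqrt p : ℂ) = (ε : ℂ) * (p : ℂ) := by
    have h0 : (τ + (Real.sqrt p : ℂ)) * (τ - (Real.sqrt p : ℂ)) = 0 := by
      rw [← sq_sub_sq, hτsq, hsqrt, sub_self]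
    rcases mul_eq_zero.mp h0 with h | h
    · refine ⟨-1, Or.inr rfl, ?_⟩
      rw [eq_neg_of_add_eq_zero_left h, neg_mul, ← sq, hsqrt]
      push_cast
      ring
    · refine ⟨1, Or.inl rfl, ?_⟩
      rw [sub_eq_zero.mp h, ← sq, hsqrt]
      push_cast
      ring
  -- Pal: `√p·Ω_E = Ω_V`, and `ϖ·Ω_V = Ω⁺_f`
  have hPal' : Real.sqrt p * W.realPeriodRat = V.realPeriodRat := hPal V W p hp4 (Or.inl hord.1) hVW
  have hΩf : ((plusPeriod f : ℝ) : ℂ) = (ϖ : ℂ) * (Real.sqrt p : ℝ) * (W.realPeriodRat : ℝ) := by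
    rw [← hϖ, ← hPal']
    push_cast
    ring
  -- non-vanishing
  have hΩW : ((W.realPeriodRat : ℝ) : ℂ) ≠ 0 := by exact_mod_cast W.realPeriodRat_pos_holds.ne'
  have hΩf' : ((plusPeriod f' : ℝ) : ℂ) ≠ 0 := by
    exact_mod_cast (IsNewform0.plusPeriod_pos_holds hfV'.1 hfV'.coeffField_eq_bot).ne'
  have hR : ((W.regulator : ℝ) : ℂ) ≠ 0 := by exact_mod_cast (W.regulator_pos_holds).ne'
  have hS'c : ((legendrePlusSymbolSum f' p : ℚ) : ℂ) ≠ 0 := by exact_mod_cast hS'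
  have hqc : (q : ℂ) ≠ 0 := by exact_mod_cast hq
  have hcc : (c : ℂ) ≠ 0 := by exact_mod_cast hc
  have hCarc : ((Car : ℝ) : ℂ) ≠ 0 := by exact_mod_cast hCar.ne'
  -- the real identity in `ℂ`
  have hρR' : ((P₁.heightPairing P₂ / 2 : ℝ) : ℂ) = (ρ : ℂ) * (W.regulator : ℂ) := by
    rw [hρR]; push_cast; ring
  rw [hρR'] at hA
  push_cast at hA
  obtain ⟨hρ, hX⟩ := arch_algebra (u := splitLocalConstant p) hA hBirch hτp hΩf hR hΩW hqc hcc hS'c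
    hCarc hΩf'
  exact ⟨hρ, ε, hε, hX⟩

omit [W.IsElliptic] [W.IsGloballyMinimal] [IsGalois ℚ K] in
/-- **STEP C(2b) — the `p`-adic side: Theorem B ÷ (rational `X`) is the branch identity.** From the
Theorem-B clause, the descended pairing `⟨P₁,P₂⟩_{DhK} = ρ·Reg_p`, STEP B(2)'s coefficient
`[T¹]G = X·[T¹]B_f·B_{f′}(0)` with `X` rational, `B_{f′}(0) = α⁻¹S′` and `Z° = u·p·α⁻²`:
`ϖ·[T¹]B_f·log_p γ = u′·c·Reg_p` with the unit `u′ = ±α⁻¹`.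
[cite: Disegni2017, Theorem B (arXiv v3 PDF p. 9)] [cite: MazurTateTeitelbaum1986Invent, §I.14 (14.3)] -/
theorem padicRatioClause_identity (hp4 : p % 4 = 1) (V : WeierstrassCurve ℚ) [V.IsElliptic]
    [V.IsGloballyMinimal] (hordin : IsOrdinaryAt V p) {N : ℕ} [NeZero N] (f : CuspForm (Gamma0 N) 2)
    {G : PowerSeries ℂ_[p]} {DhK : PAdicHeightDataK W p K} {Dh : PAdicHeightData W p}
    {P₁ P₂ : (W.baseChange K).toAffine.Point} {q ρ c S' ϖ ε : ℚ} {σ₀ : ℤˣ} {X B₂ : ℂ_[p]}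
    (hq : q ≠ 0) (hρ : ρ ≠ 0) (hc : c ≠ 0) (hS' : S' ≠ 0) (hε : ε = 1 ∨ ε = -1)
    (hPad : PAdicRatioClause W K ((unitRoot V p : ℤ_[p]) : ℚ_[p]) G DhK P₁ P₂ q σ₀)
    (hρp : DhK.pairing P₁ P₂ = (ρ : ℚ_[p]) * ((1 : ℕ) : ℚ_[p]) * padicRegulator Dh)
    (hcoef : PowerSeries.coeff 1 G = X *
      algebraMap ℚ_[p] ℂ_[p] (PowerSeries.coeff 1
        (padicLFunctionBranch f ((unitRoot V p : ℤ_[p]) : ℚ_[p]) (p / 2))) * B₂)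
    (hB2 : B₂ = algebraMap ℚ_[p] ℂ_[p] (((unitRoot V p : ℤ_[p]) : ℚ_[p])⁻¹ * (S' : ℚ_[p])))
    (hX : X = algebraMap ℚ_[p] ℂ_[p]
      ((ε * (2 * splitLocalConstant p * ϖ * ρ * p / (q * c * S')) : ℚ) : ℚ_[p])) :
    ∃ u : ℤ_[p]ˣ, (ϖ : ℚ_[p]) *
        PowerSeries.coeff 1 (padicLFunctionBranch f ((unitRoot V p : ℤ_[p]) : ℚ_[p]) (p / 2)) *
        padicLog p (cyclotomicGenerator p) = ((u : ℤ_[p]) : ℚ_[p]) * (c : ℚ_[p]) * padicRegulator Dh := by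
  have hpP : p.Prime := hp.out
  set α : ℚ_[p] := ((unitRoot V p : ℤ_[p]) : ℚ_[p]) with hαdef
  set B₁ := padicLFunctionBranch f α (p / 2) with hB₁
  set ℓγ : ℚ_[p] := padicLog p (cyclotomicGenerator p) with hℓγ
  -- Theorem B in `ℚ_p`
  rw [padicRatioClause_iff, hρp, hcoef, hB2, hX, Nat.cast_one, mul_one] at hPad
  have hPad' : (ρ : ℚ_[p]) * padicRegulator Dh =
      ((σ₀ : ℤ) : ℚ_[p]) * (q : ℚ_[p]) * ((zCircOne p α)⁻¹ * 2⁻¹ * ℓγ) *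
        ((((ε * (2 * splitLocalConstant p * ϖ * ρ * p / (q * c * S'))) : ℚ) : ℚ_[p]) *
          PowerSeries.coeff 1 B₁ * (α⁻¹ * (S' : ℚ_[p]))) := by
    apply (algebraMap ℚ_[p] ℂ_[p]).injective
    simp only [map_mul, map_ratCast, map_intCast, map_inv₀, map_ofNat] at hPad ⊢
    linear_combination hPad
  -- the unit root
  have hαunit : IsUnit (unitRoot V p) := (unitRoot_spec_holds V p hordin).2
  have hα0 : α ≠ 0 := by
    rw [hαdef, ne_eq, PadicInt.coe_eq_zero]
    exact hαunit.ne_zero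
  have hαinv : (((hαunit.unit⁻¹ : ℤ_[p]ˣ) : ℤ_[p]) : ℚ_[p]) = α⁻¹ := by
    have h2' : ((hαunit.unit⁻¹ : ℤ_[p]ˣ) : ℤ_[p]) * unitRoot V p = 1 := by
      have h1 := hαunit.unit.inv_mul
      rwa [IsUnit.unit_spec] at h1
    have h : (((hαunit.unit⁻¹ : ℤ_[p]ˣ) : ℤ_[p]) : ℚ_[p]) * α = 1 := by
      rw [hαdef, ← PadicInt.coe_mul, h2', PadicInt.coe_one]
    exact eq_inv_of_mul_eq_one_left h
  -- `Z° = u·p*·α⁻²`, `p* = p`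
  have hpstar : (pStar p : ℚ_[p]) = (p : ℚ_[p]) := by
    rw [pStar, show (p - 1) / 2 = p / 2 by omega, neg_one_pow_half_eq_one_of_mod_four_eq_one p hp4]
    push_cast; ring
  have hu0 : (splitLocalConstant p : ℚ_[p]) ≠ 0 := by exact_mod_cast splitLocalConstant_ne_zero p
  have hpp : (p : ℚ_[p]) ≠ 0 := by exact_mod_cast hpP.ne_zero
  have hqp : (q : ℚ_[p]) ≠ 0 := by exact_mod_cast hq
  have hcp' : (c : ℚ_[p]) ≠ 0 := by exact_mod_cast hc
  have hS'p : (S' : ℚ_[p]) ≠ 0 := by exact_mod_cast hS'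
  have hρp' : (ρ : ℚ_[p]) ≠ 0 := by exact_mod_cast hρ
  -- the sign `σ₀·ε`
  have hσ₀ : ((σ₀ : ℤ) : ℚ_[p]) = 1 ∨ ((σ₀ : ℤ) : ℚ_[p]) = -1 := by
    rcases Int.units_eq_one_or σ₀ with h | h <;> simp [h]
  have hεp : (ε : ℚ_[p]) = 1 ∨ (ε : ℚ_[p]) = -1 := by
    rcases hε with h | h <;> simp [h]
  have hs2 : (((σ₀ : ℤ) : ℚ_[p]) * (ε : ℚ_[p])) ^ 2 = 1 := by
    rcases hσ₀ with h | h <;> rcases hεp with h' | h' <;> rw [h, h'] <;> norm_num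
  rw [zCircOne] at hPad'
  have key := padic_algebra hPad' hpstar hs2 hρp' hqp hcp' hS'p hu0 hα0 hpp
  -- package the unit
  have hsign : ((σ₀ : ℤ) : ℚ_[p]) * (ε : ℚ_[p]) = 1 ∨ ((σ₀ : ℤ) : ℚ_[p]) * (ε : ℚ_[p]) = -1 := by
    rcases hσ₀ with h | h <;> rcases hεp with h' | h' <;> rw [h, h'] <;> norm_num
  rcases hsign with hs | hs
  · refine ⟨hαunit.unit⁻¹, ?_⟩
    rw [key, hs, one_mul, hαinv]
  · refine ⟨-hαunit.unit⁻¹, ?_⟩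
    rw [key, hs, Units.val_neg, PadicInt.coe_neg, hαinv]
    ring

/-- **STEP C(2) — the twisted-branch `p`-adic Gross–Zagier identity at `(V, f, ϖ)` from Disegni's
clauses.** See the module docstring for the statement and the computation.
[cite: Disegni2017, Theorem A (arXiv v3 PDF pp. 7–8), Theorem B (PDF p. 9), (1.1.3) (PDF pp. 4–5)]
[cite: GrossZagier1986, Thm. I.(7.3)] [cite: Pal2012, Thm. 3.2] [cite: MazurTateTeitelbaum1986Invent, §I.8 (8.6), §I.14] -/
theorem branchPAdicGrossZagier_identity_of_cycLine (hp4 : p % 4 = 1)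
    (hArt : rankinSelbergEulerProductHecke_baseChangeDirichlet_eq) (h73 : GrossZagier1986_thm_I_7_3)
    (hPal : Pal2012.thm32_sqrt_mul_realPeriodRat_twist_eq_of_prime_one_mod_four)
    (hmod : hasEntireLFunction_rat) (hGZK : rank_eq_analyticRank_of_analyticRank_le_one)
    -- the quadratic field and its character
    (h2 : Module.finrank ℚ K = 2) (κ : DirichletCharacter ℂ (NumberField.discr K).natAbs)
    (hκ : ∀ ℓ : ℕ, ℓ.Prime → ℓ ≠ 2 → κ ℓ = (jacobiSym (NumberField.discr K) ℓ : ℂ))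
    (hκ2 : κ 2 = if NumberField.discr K % 8 = 1 then 1
        else if NumberField.discr K % 8 = 5 then -1 else 0)
    (hpd : Nat.Coprime p (NumberField.discr K).natAbs)
    (hrd : (W.quadraticTwist (NumberField.discr K : ℚ)).mordellWeilRank = 0)
    -- the curve, its good twist, the twist by `κ`
    (hadd : Addv W p) (hr : W.analyticRank = 1)
    (V V' : WeierstrassCurve ℚ) [V.IsElliptic] [V.IsGloballyMinimal] [V'.IsElliptic] [V'.IsGloballyMinimal]
    (hVW : ∃ C : VariableChange ℚ, C • V.quadraticTwist (p : ℚ) = W) (hord : GoodOrd V p)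
    (hordV' : IsOrdinaryAt V' p) (hap : V'.frobeniusTrace p = V.frobeniusTrace p)
    {N NE N' : ℕ} [NeZero N] [NeZero NE] [NeZero N'] {f : CuspForm (Gamma0 N) 2}
    {fE : CuspForm (Gamma0 NE) 2} {f' : CuspForm (Gamma0 N') 2}
    (hfV : IsNewformOf V f) (hfE : IsNewformOf W fE) (hfV' : IsNewformOf V' f')
    (hV' : ∀ n : ℕ, cuspCoeff f' n = κ (n : ZMod (NumberField.discr K).natAbs) * cuspCoeff f n)
    (hS' : legendrePlusSymbolSum f' p ≠ 0)
    (ϖ : ℚ) (hϖ : (ϖ : ℝ) * V.realPeriodRat = plusPeriod f)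
    -- the height data carrying Disegni's clauses
    {Dh : PAdicHeightData W p} {DhK : PAdicHeightDataK W p K} (hres : DhK.RestrictsToWith Dh 1)
    (hGZc : CycLineGrossZagierClauses W K ι fE (unitRoot V p : ℚ_[p]) DhK) :
    ∃ (u : ℤ_[p]ˣ) (q : ℚ),
      W.leadingLCoeff = (q : ℂ) * (W.realPeriodRat : ℂ) * (W.regulator : ℂ) ∧
      (ϖ : ℚ_[p]) *
          PowerSeries.coeff 1 (padicLFunctionBranch f ((unitRoot V p : ℤ_[p]) : ℚ_[p]) (p / 2)) *
          padicLog p (cyclotomicGenerator p) =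
        ((u : ℤ_[p]) : ℚ_[p]) * (q : ℚ_[p]) * padicRegulator Dh := by
  haveI : NeZero p := ⟨hp.out.ne_zero⟩
  have hp2 : p ≠ 2 := by omega
  have hordin : IsOrdinaryAt V p := ⟨hord.1, hord.2⟩
  -- unpack Disegni's clauses
  obtain ⟨Car, hCar, G, hG, P₁, P₂, q, σ₀, hq, hArch, hPad⟩ := hGZc
  -- STEP B(2): `[T¹]G = c_p·[T¹]B_f·B_{f'}(0)`
  have hE : ∀ n : ℕ, cuspCoeff fE n = (legendreSym p (n : ℤ) : ℂ) * cuspCoeff f n := by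
    intro n
    rw [hfE.2 n, intCast_LFunction_eq_jacobiChar_mul_cuspCoeff p hp4 V W hVW hadd hfV n,
      jacobiChar_natCast, ← jacobiSym.legendreSym.to_jacobiSym]
  have hB0 : PowerSeries.constantCoeff
      (padicLFunctionBranch f ((unitRoot V p : ℤ_[p]) : ℚ_[p]) (p / 2)) = 0 :=
    constantCoeff_branch_eq_zero_of_analyticRank_eq_one W p hPal hmod hadd hr hp4 V hVW hord hfV ϖ hϖ
  have hcoef := coeff_one_cycLine_eq ι K hp4 hArt h2 κ hκ hκ2 hpd V V' hordin hordV' hap hfV hfE.1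
    hfV' hE hV' hG hB0
  have hα' : unitRoot V' p = unitRoot V p := unitRoot_eq_of_frobeniusTrace_eq hap
  have hB2 : algebraMap ℚ_[p] ℂ_[p]
      (PowerSeries.constantCoeff (padicLFunctionBranch f' (unitRoot V' p : ℚ_[p]) (p / 2))) =
      algebraMap ℚ_[p] ℂ_[p] (((unitRoot V p : ℤ_[p]) : ℚ_[p])⁻¹ *
        (legendrePlusSymbolSum f' p : ℚ_[p])) := by
    rw [constantCoeff_padicLFunctionBranch_half p hp2 V' hordV' hfV', hα']
  -- STEP C(1): one rational `ρ`
  have hrk : W.mordellWeilRank = 1 := by rw [(hGZK W (by rw [hr])).1, hr]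
  obtain ⟨ρ, hρR, hρp⟩ := exists_rat_heightPairing_eq_and_pairing_eq K h2 hrk hrd hres P₁ P₂
  rw [h2] at hρR
  -- Gross–Zagier I.(7.3): `L'(E,1) = c·Ω_E·Reg_∞`
  obtain ⟨hlead, -⟩ := leadingLCoeff_eq_deriv_of_analyticRank_eq_one hr
  obtain ⟨c, hc, hcL⟩ := leadingLCoeff_eq_rat_mul_of_analyticRank_eq_one h73 hr hrk
  rw [hlead] at hcL
  -- (2a) the archimedean side: `X` is rational
  obtain ⟨hρ, ε, hε, hX⟩ := archRatioClause_rational K hp4 hArt hPal hmod h2 κ hκ hκ2 hadd hr V V'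
    hVW hord hfV hfE hfV' hV' hS' ϖ hϖ hc hcL hCar hq hArch hρR
  have hXp : ((ι.symm ((splitLocalConstant p : ℂ) * (Car : ℂ) * (plusPeriod f : ℂ) *
      (plusPeriod f' : ℂ)) : PadicAlgCl p) : ℂ_[p]) = algebraMap ℚ_[p] ℂ_[p]
      ((ε * (2 * splitLocalConstant p * ϖ * ρ * p / (q * c * legendrePlusSymbolSum f' p)) : ℚ) :
        ℚ_[p]) := by
    rw [hX, coe_symm_ratCast, map_ratCast]
  -- (2b) the `p`-adic side
  obtain ⟨u, hu⟩ := padicRatioClause_identity K hp4 V hordin f hq hρ hc hS' hε hPad hρp hcoef hB2 hXp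
  exact ⟨u, c, by rw [hlead, hcL]; push_cast; ring, hu⟩

end Identity

end Summit.BirchSwinnertonDyer.Rank1Residual.Additive
end
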